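import Mathlib
import Literature.Analysis.FluidPDE.SelfSimilarEulerProfile
import HarnessLib

/-!
# BACKWARD BLOB RADIAL ESCAPE — Grönwall for the radius along orbits of the similarity transport field
# (crux `EulerZoomLiouville.PowerGaugeEulerLiouville` = stmt-NavierStokesRegularity-19832; LEAD ns-typeII-p2 g11 key (L1), RESIDUE-MEMO-19832-g11 §2 (C2) ODE input)

Route `EulerZoomLiouville` (NavierStokesRegularity); width seat ns-ezl-w6.  Let `W = γ y + V(y)` be the similarity transport field of a profile `V`
(`selfSimilarTransport γ 0 V`).  Along a BACKWARD orbit `Y' = −W(Y)` that stays in a FAST-INFLOW region `⟪Y, W Y⟫ ≤ −c₁‖Y‖²` the radius grows at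
least exponentially, `‖Y t‖ ≥ ‖Y t₀‖ e^{c₁(t−t₀)}`: with `g = ‖Y‖²`, `g' = −2⟪Y, W Y⟫ ≥ 2c₁ g`, so `e^{−2c₁t} g` is non-decreasing.  The forward twin
(`Y' = W(Y)`, `⟪Y, W Y⟫ ≥ c₁‖Y‖²`) and the upper twin (`⟪Y, W Y⟫ ≥ −C₁‖Y‖²` ⇒ `‖Y t‖ ≤ ‖Y t₀‖ e^{C₁(t−t₀)}`) are the same computation.  These are the
ODE inputs of the LEAD's «Bernoulli-channel calculus» (C2): a blob of vortical points in the high set `Θ_h` that travels backward through a fast channel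
`s − γ ≥ c` sits at radii `≥ R₀ e^{c(t−n)}`.

* `BackwardEscape.norm_ge_mul_exp_of_fastInflow` — backward orbit in a fast-inflow region: exponential LOWER bound on the radius;
* `BackwardEscape.norm_ge_mul_exp_of_fastOutflow_forward` — forward orbit in a fast-outflow region: the same lower bound;
* `BackwardEscape.norm_le_mul_exp_of_inflow_ge` — backward orbit with `⟪Y, W Y⟫ ≥ −C₁‖Y‖²`: exponential UPPER bound.

WHAT THIS IS NOT: not NS, not E — pure ODE lemmas (Mathlib + the Literature definition `selfSimilarTransport`), `--supports` stmt-19832; 19832 OPEN.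
[folklore; cf. ConstantinIgnatovaVicol2026Putative §3.4 (3.19)–(3.20)]
-/

noncomputable section

-- flat `Theorems/<Route><Decl>…` files of one crux share the namespace of the crux (tree convention: `Summit.<S>.<S>.…`)
set_option linter.dupNamespace false

open Set Filter Topology
open scoped RealInnerProductSpace

namespace Summit.NavierStokesRegularity.NavierStokesRegularity.Theorems.PowerGaugeEulerLiouville

open Literature.Analysis.FluidPDE

namespace BackwardEscape

variable {V : EuclideanSpace ℝ (Fin 3) → EuclideanSpace ℝ (Fin 3)} {γ : ℝ} {Y : ℝ → EuclideanSpace ℝ (Fin 3)}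

/-- **Grönwall from below for the squared radius.**  If `g : ℝ → ℝ` has `g' ≥ 2c₁ g` on `[t₀, t₁]` (derivative `g'` given pointwise), then
`g t₀ · e^{2c₁(t − t₀)} ≤ g t` on `[t₀, t₁]` (the function `e^{−2c₁ t} g` is non-decreasing). [folklore] -/
theorem mul_exp_le_of_deriv_ge {g g' : ℝ → ℝ} {c₁ t₀ t₁ : ℝ}
    (hg : ∀ t ∈ Icc t₀ t₁, HasDerivAt g (g' t) t) (hg' : ∀ t ∈ Icc t₀ t₁, 2 * c₁ * g t ≤ g' t) :
    ∀ t ∈ Icc t₀ t₁, g t₀ * Real.exp (2 * c₁ * (t - t₀)) ≤ g t := by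
  intro t ht
  -- `h s = exp(−2c₁ s) g s` is monotone on `[t₀, t₁]`
  set h : ℝ → ℝ := fun s => Real.exp (-(2 * c₁ * s)) * g s with hh
  have hderiv : ∀ s ∈ Icc t₀ t₁,
      HasDerivAt h (Real.exp (-(2 * c₁ * s)) * (g' s - 2 * c₁ * g s)) s := by
    intro s hs
    have h1 : HasDerivAt (fun s : ℝ => Real.exp (-(2 * c₁ * s))) (Real.exp (-(2 * c₁ * s)) * (-(2 * c₁))) s := by
      have := ((hasDerivAt_id s).const_mul (2 * c₁)).neg.exp
      simpa using this
    have h2 := h1.mul (hg s hs)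
    have e : Real.exp (-(2 * c₁ * s)) * (-(2 * c₁)) * g s + Real.exp (-(2 * c₁ * s)) * g' s =
        Real.exp (-(2 * c₁ * s)) * (g' s - 2 * c₁ * g s) := by ring
    rw [e] at h2
    exact h2
  have hmono : MonotoneOn h (Icc t₀ t₁) := by
    have hcont : ContinuousOn h (Icc t₀ t₁) := fun s hs => (hderiv s hs).continuousAt.continuousWithinAt
    have hdiff : DifferentiableOn ℝ h (interior (Icc t₀ t₁)) := by
      rw [interior_Icc]
      exact fun s hs => (hderiv s (Ioo_subset_Icc_self hs)).differentiableAt.differentiableWithinAt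
    refine monotoneOn_of_deriv_nonneg (convex_Icc t₀ t₁) hcont hdiff fun s hs => ?_
    rw [interior_Icc] at hs
    have hs' : s ∈ Icc t₀ t₁ := Ioo_subset_Icc_self hs
    rw [(hderiv s hs').deriv]
    exact mul_nonneg (Real.exp_nonneg _) (by linarith [hg' s hs'])
  have hle : h t₀ ≤ h t := hmono (left_mem_Icc.2 (ht.1.trans ht.2)) ht ht.1
  simp only [hh] at hle
  -- unfold: `exp(−2c₁t₀) g t₀ ≤ exp(−2c₁ t) g t`
  have hexp : Real.exp (2 * c₁ * (t - t₀)) = Real.exp (-(2 * c₁ * t₀)) / Real.exp (-(2 * c₁ * t)) := by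
    rw [← Real.exp_sub]; congr 1; ring
  rw [hexp, mul_div_assoc', div_le_iff₀ (Real.exp_pos _)]
  calc g t₀ * Real.exp (-(2 * c₁ * t₀)) = Real.exp (-(2 * c₁ * t₀)) * g t₀ := by ring
    _ ≤ Real.exp (-(2 * c₁ * t)) * g t := hle
    _ = g t * Real.exp (-(2 * c₁ * t)) := by ring

/-- From `‖Y t₀‖² e^{2c₁(t−t₀)} ≤ ‖Y t‖²` to `‖Y t₀‖ e^{c₁(t−t₀)} ≤ ‖Y t‖`. [folklore] -/
theorem norm_mul_exp_le_of_sq {a b c₁ t t₀ : ℝ} (ha : 0 ≤ a) (hb : 0 ≤ b)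
    (h : a ^ 2 * Real.exp (2 * c₁ * (t - t₀)) ≤ b ^ 2) : a * Real.exp (c₁ * (t - t₀)) ≤ b := by
  have he : Real.exp (2 * c₁ * (t - t₀)) = Real.exp (c₁ * (t - t₀)) ^ 2 := by
    rw [← Real.exp_nat_mul]; congr 1; push_cast; ring
  rw [he, ← mul_pow] at h
  exact (pow_le_pow_iff_left₀ (mul_nonneg ha (Real.exp_nonneg _)) hb two_ne_zero).1 h

/-- **BACKWARD ORBITS IN A FAST-INFLOW REGION ESCAPE EXPONENTIALLY.**  Let `Y` solve the BACKWARD similarity flow `Y' = −W(Y)`,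
`W = selfSimilarTransport γ 0 V` (`W y = γ y + V y`), on `[t₀, t₁]`, and suppose the orbit stays in the fast-inflow region
`⟪Y t, W (Y t)⟫ ≤ −c₁ ‖Y t‖²`.  Then `‖Y t₀‖ · e^{c₁ (t − t₀)} ≤ ‖Y t‖` for all `t ∈ [t₀, t₁]`. [folklore; cf. ConstantinIgnatovaVicol2026Putative §3.4] -/
theorem norm_ge_mul_exp_of_fastInflow {c₁ t₀ t₁ : ℝ} (ht : t₀ ≤ t₁)
    (hY : ∀ t ∈ Icc t₀ t₁, HasDerivAt Y ((-1 : ℝ) • selfSimilarTransport γ 0 V (Y t)) t)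
    (hfast : ∀ t ∈ Icc t₀ t₁, ⟪Y t, selfSimilarTransport γ 0 V (Y t)⟫ ≤ -(c₁ * ‖Y t‖ ^ 2)) :
    ∀ t ∈ Icc t₀ t₁, ‖Y t₀‖ * Real.exp (c₁ * (t - t₀)) ≤ ‖Y t‖ := by
  have _h := ht
  -- `g = ‖Y‖²`, `g' = 2⟪Y, −W Y⟫ ≥ 2 c₁ g`
  have hg : ∀ t ∈ Icc t₀ t₁, HasDerivAt (fun s => ‖Y s‖ ^ 2)
      (2 * ⟪Y t, (-1 : ℝ) • selfSimilarTransport γ 0 V (Y t)⟫) t :=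
    fun t ht => (hY t ht).norm_sq
  have hg' : ∀ t ∈ Icc t₀ t₁, 2 * c₁ * ‖Y t‖ ^ 2 ≤ 2 * ⟪Y t, (-1 : ℝ) • selfSimilarTransport γ 0 V (Y t)⟫ := by
    intro t ht
    rw [inner_smul_right]
    have := hfast t ht
    linarith
  intro t ht'
  have h := mul_exp_le_of_deriv_ge (g := fun s => ‖Y s‖ ^ 2) hg hg' t ht'
  exact norm_mul_exp_le_of_sq (norm_nonneg _) (norm_nonneg _) h

/-- **FORWARD ORBITS IN A FAST-OUTFLOW REGION ESCAPE EXPONENTIALLY** (forward twin).  `Y' = W(Y)` on `[t₀, t₁]` with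
`c₁ ‖Y t‖² ≤ ⟪Y t, W (Y t)⟫` ⇒ `‖Y t₀‖ · e^{c₁ (t − t₀)} ≤ ‖Y t‖`. [folklore; cf. ConstantinIgnatovaVicol2026Putative §3.4] -/
theorem norm_ge_mul_exp_of_fastOutflow_forward {c₁ t₀ t₁ : ℝ} (ht : t₀ ≤ t₁)
    (hY : ∀ t ∈ Icc t₀ t₁, HasDerivAt Y (selfSimilarTransport γ 0 V (Y t)) t)
    (hfast : ∀ t ∈ Icc t₀ t₁, c₁ * ‖Y t‖ ^ 2 ≤ ⟪Y t, selfSimilarTransport γ 0 V (Y t)⟫) :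
    ∀ t ∈ Icc t₀ t₁, ‖Y t₀‖ * Real.exp (c₁ * (t - t₀)) ≤ ‖Y t‖ := by
  have _h := ht
  have hg : ∀ t ∈ Icc t₀ t₁, HasDerivAt (fun s => ‖Y s‖ ^ 2)
      (2 * ⟪Y t, selfSimilarTransport γ 0 V (Y t)⟫) t :=
    fun t ht => (hY t ht).norm_sq
  have hg' : ∀ t ∈ Icc t₀ t₁, 2 * c₁ * ‖Y t‖ ^ 2 ≤ 2 * ⟪Y t, selfSimilarTransport γ 0 V (Y t)⟫ := by
    intro t ht
    have := hfast t ht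
    linarith
  intro t ht'
  have h := mul_exp_le_of_deriv_ge (g := fun s => ‖Y s‖ ^ 2) hg hg' t ht'
  exact norm_mul_exp_le_of_sq (norm_nonneg _) (norm_nonneg _) h

/-- **BACKWARD ORBITS GROW AT MOST EXPONENTIALLY WHERE THE INFLOW RATE IS BOUNDED** (upper twin).  `Y' = −W(Y)` on `[t₀, t₁]` with
`−C₁ ‖Y t‖² ≤ ⟪Y t, W (Y t)⟫` ⇒ `‖Y t‖ ≤ ‖Y t₀‖ · e^{C₁ (t − t₀)}`. [folklore; cf. ConstantinIgnatovaVicol2026Putative §3.4] -/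
theorem norm_le_mul_exp_of_inflow_ge {C₁ t₀ t₁ : ℝ} (ht : t₀ ≤ t₁)
    (hY : ∀ t ∈ Icc t₀ t₁, HasDerivAt Y ((-1 : ℝ) • selfSimilarTransport γ 0 V (Y t)) t)
    (hslow : ∀ t ∈ Icc t₀ t₁, -(C₁ * ‖Y t‖ ^ 2) ≤ ⟪Y t, selfSimilarTransport γ 0 V (Y t)⟫) :
    ∀ t ∈ Icc t₀ t₁, ‖Y t‖ ≤ ‖Y t₀‖ * Real.exp (C₁ * (t - t₀)) := by
  have _h := ht
  intro t ht'
  -- apply the lower Grönwall lemma to `g = −‖Y‖²` with rate `C₁`: `g' = −2⟪Y, −W Y⟫ = 2⟪Y, W Y⟫ ≥ −2C₁‖Y‖² = 2 C₁ g`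
  have hg : ∀ s ∈ Icc t₀ t₁, HasDerivAt (fun s => -(‖Y s‖ ^ 2))
      (-(2 * ⟪Y s, (-1 : ℝ) • selfSimilarTransport γ 0 V (Y s)⟫)) s :=
    fun s hs => (hY s hs).norm_sq.neg
  have hg' : ∀ s ∈ Icc t₀ t₁, 2 * C₁ * (-(‖Y s‖ ^ 2)) ≤ -(2 * ⟪Y s, (-1 : ℝ) • selfSimilarTransport γ 0 V (Y s)⟫) := by
    intro s hs
    rw [inner_smul_right]
    have := hslow s hs
    linarith
  have h := mul_exp_le_of_deriv_ge (g := fun s => -(‖Y s‖ ^ 2)) hg hg' t ht'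
  -- `−‖Y t₀‖² e^{2C₁(t−t₀)} ≤ −‖Y t‖²`
  have h2 : ‖Y t‖ ^ 2 ≤ (‖Y t₀‖ * Real.exp (C₁ * (t - t₀))) ^ 2 := by
    have he : Real.exp (2 * C₁ * (t - t₀)) = Real.exp (C₁ * (t - t₀)) ^ 2 := by
      rw [← Real.exp_nat_mul]; congr 1; push_cast; ring
    rw [mul_pow, ← he]
    linarith
  exact (pow_le_pow_iff_left₀ (norm_nonneg _) (mul_nonneg (norm_nonneg _) (Real.exp_nonneg _)) two_ne_zero).1 h2

end BackwardEscape

end Summit.NavierStokesRegularity.NavierStokesRegularity.Theorems.PowerGaugeEulerLiouville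

end
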